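import Literature.IUT.LogVolume.Theorem110RealStepII
import Literature.IUT.LogVolume.Theorem110Data
import Literature.IUT.LogVolume.IdealArithmeticDivisors
import Literature.IUT.LogVolume.RArithmeticDivisorsPullback
import HarnessLib

/-!
# [IUTchIV] Theorem 1.10, Steps (ii)–(iii) as TOWER ARITHMETIC for the `λ`-line: the K-level Step (v) bound
# `δ_K` is at most the printed Step (iii) FINAL display `B_III(P, l)`, plus the two vocabulary bridges

Mochizuki, *Inter-universal Teichmüller theory IV*, RIMS manuscript (Apr. 2020; = PRIMS **57** (2021)), Thm. 1.10
proof Step (ii) p. 24, Step (iii) pp. 25–26 (final display: "`(1 + 4/l)·log(𝔡^K) + (4/l)·log(𝔰^ℚ) ≤ (1 +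
12·d_mod/l)·(log(𝔡^{F_tpd}) + log(𝔣^{F_tpd})) + 2·log(l) + 52`"), Step (v) p. 29; `e_mod ≤ d_mod`, `e*_mod ≤ d*_mod`
(p. 22); `log(𝔰^≤) = #{p ∈ 𝕍^dst : p ≤ e*_mod·l} ≤ π(e*_mod·l)` (p. 25). TAKES NO SIDE on [IUTchIII] Cor. 3.12.

The cell's layer-2 skeleton of the crux `ThetaPartII` (stmt-ABC-19678, v1.2, abc-iut-plan 2026-08-26T02:24:55Z)
types the log-volume child as `Cor22.HullVolumeAtDatum P l (B_III P l)` with the PRINT-VERBATIM constant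

  `B_III(P,l) := (l+1)/4·{(1 + 12·d_mod/l)·(log-diff + log 𝔣^{∤{2,l}}) + 2·log l + 52 + (20/3)·log(d*·l)·π(d*·l)}`,

and its support plan splits it into S-a (log-volume: `δΣ(T) ≤ δ_K(T)` in the K-level currency
`δ_K := (l+1)/4·{(1 + 4/l)·log(𝔡^K) + (4/l)·log(𝔰^ℚ) + (20/3)·log(e*_mod·l)·log(𝔰^≤)}`, abc-iut-c312-d1) and S-b
(TOWER ARITHMETIC: `δ_K(T) ≤ B_III(P,l)`, abc-iut-S3). THIS FILE is the number-free half of S-b: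

* `Cor22.deltaK_le_BIII` — for a prime `l ≥ 5`, `1 ≤ e_mod ≤ d_mod`, nonnegative reals `log(𝔡^K)`, `log(𝔰^ℚ)`,
  `log(𝔰^≤)` satisfying the COMBINED Step (ii) bound `log(𝔡^K) ≤ log(𝔡^{F_tpd}) + log(𝔣^{F_tpd}) + log(2^11·3^3·5^2)
  + 2·log(l)` (ii-K), the Step (iii) bound `log(𝔰^ℚ) ≤ 2·d_mod·(log(𝔡^{F_tpd}) + log(𝔣^{F_tpd})) + log(2·3·5·l)` and
  `log(𝔰^≤) ≤ π(e*_mod·l)`: `δ_K ≤ B_III(P,l)` (exact bytes of the registered constant). The Steps (ii)/(iii)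
  arithmetic is abc-iut-S3's `Thm110Numerics.stepiii_final` (`Theorem110Data.lean`) VERBATIM (instantiated at the
  numerics of the point — zero new arithmetic); the `𝔰^≤`-term is monotonicity of `log` and `π` in `e_mod ≤ d_mod`.
* `Cor22.logCondAvoid_eq_ndeg_reduced` — `log 𝔣^{∤S}(λ) = deĝ(Σ_{v ∈ 𝕍(F_tpd)^bad} v)`: the `λ`-line conductor
  (abc-iut-S-d2's `Cor22.logCondAvoid`) IS the normalised degree of the reduced arithmetic divisor on
  `badPlacesAvoid P S` in the `ADivisor` currency of abc-iut-L5-t15's tower bounds (`ndeg F (ADivisor.reduced S)`),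
  companion of the tree's `logDiff_eq_ndeg_differentDivisor`;
* `Cor22.finBelow_mem_badPlacesAvoid_iff` — for an extension `K ⊇ F_tpd`, a place `u` of `K` lies in
  `badPlacesOver P S K` iff `finBelow F_tpd K u ∈ badPlacesAvoid P S`: the saturation hypothesis `hT` of
  `ndeg_different_add_reduced_le(_theta)` / `sum_log_distinguished_le` for `T := badPlacesOver`, `S₀ := badPlacesAvoid`.

[cite: Mochizuki2012, IUTchIV Thm. 1.10 proof Step (iii) p. 26] [cite: Mochizuki2012, IUTchIV Thm. 1.10 proof Step (v)
p. 29] [claim: Mochizuki2012, status: disputed] for every IUT quotation. Classical bookkeeping; nothing here asserts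
any of the bounds for a genuine datum (they are hypotheses) and nothing bears on Cor. 3.12.
-/

noncomputable section

namespace Literature.IUT.LogVolume

namespace Cor22

open NumberField IsDedekindDomain
open Literature.NumberTheory.DiophantineGeometry.GenEll
open scoped Nat.Prime

/-! ## The two vocabulary bridges -/

/-- **`log(𝔣^{F_tpd}) = deĝ(𝔣^{F_tpd}_ADiv)`** in the `ADivisor` currency: the `λ`-line conductor away from `S` is the
normalised degree of the reduced divisor on the bad places away from `S` ("the effective arithmetic divisor whose
support coincides with `Supp(𝔮)`, but all of whose coefficients are equal to `1`", p. 23).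
[cite: Mochizuki2012, IUTchIV Thm. 1.10 p. 23] -/
theorem logCondAvoid_eq_ndeg_reduced (P : NFPoint) (S : Finset ℕ) :
    logCondAvoid P S = ndeg P.F (ADivisor.reduced (badPlacesAvoid P S)) := by
  rw [logCondAvoid_eq_sum, ndeg_apply, ADivisor.degF_reduced_eq_sum, div_eq_inv_mul]
  rfl

/-- `log-diff(λ) + log(𝔣^{F_tpd}) = deĝ(𝔡^{F_tpd}_ADiv) + deĝ(𝔣^{F_tpd}_ADiv)` — the right-hand side of the tower bounds
in the `λ`-line's currency. [cite: Mochizuki2012, IUTchIV Thm. 1.10 p. 23] -/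
theorem logDiff_add_logCondAvoid_eq_ndeg (P : NFPoint) (S : Finset ℕ) :
    P.logDiff + logCondAvoid P S =
      ndeg P.F (differentDivisor P.F) + ndeg P.F (ADivisor.reduced (badPlacesAvoid P S)) := by
  rw [logDiff_eq_ndeg_differentDivisor, logCondAvoid_eq_ndeg_reduced]

/-- **The saturation of `𝕍(K)^bad` over `𝕍(F_tpd)^bad`**: for an extension `K ⊇ F_tpd`, a finite place `u` of `K`
lies in `badPlacesOver P S K` iff the place of `F_tpd` under it is bad away from `S` — the hypothesis `hT` of the
tower bounds (`T := badPlacesOver P S K`, `S₀ := badPlacesAvoid P S`; "`𝕍(F□)^bad := 𝕍^bad_mod ×_{𝕍_mod} 𝕍(F□)`",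
p. 23). [cite: Mochizuki2012, IUTchIV Thm. 1.10 p. 23] -/
theorem finBelow_mem_badPlacesAvoid_iff (P : NFPoint) (S : Finset ℕ) (K : Type) [Field K] [NumberField K]
    [Algebra P.F K] (u : HeightOneSpectrum (𝓞 K)) :
    u ∈ badPlacesOver P S K ↔ finBelow P.F K u ∈ badPlacesAvoid P S := by
  rw [mem_badPlacesOver_iff]
  have h : finBelow P.F K u = u.under (𝓞 P.F) :=
    HeightOneSpectrum.ext (by rw [HeightOneSpectrum.under_asIdeal]; rfl)
  rw [h]

/-! ## `δ_K ≤ B_III(P, l)` -/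

variable {P : NFPoint} {l : ℕ}

/-- `log(e*_mod·l)·log(𝔰^≤) ≤ log(d*_mod·l)·π(d*_mod·l)` from `e_mod ≤ d_mod` and `log(𝔰^≤) ≤ π(e*_mod·l)`
(`e*_mod ≤ d*_mod`, p. 22; `ι_{w_ℚ} = 1` iff `p_{w_ℚ} ≤ e*_mod·l`, p. 25). [cite: Mochizuki2012, IUTchIV Thm. 1.10 p. 22, 25] -/
theorem log_estar_mul_sLe_le (hl : 1 ≤ l) {emod dmod : ℕ} (hemod : 1 ≤ emod) (hed : emod ≤ dmod) {sLe : ℝ}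
    (hsLele : sLe ≤ (π (2 ^ 12 * 3 ^ 3 * 5 * emod * l) : ℝ)) :
    Real.log ((2 : ℝ) ^ 12 * 3 ^ 3 * 5 * emod * l) * sLe ≤
      Real.log (((2 ^ 12 * 3 ^ 3 * 5 * dmod : ℕ) : ℝ) * (l : ℝ)) * (π (2 ^ 12 * 3 ^ 3 * 5 * dmod * l) : ℝ) := by
  have he1 : (1 : ℝ) ≤ emod := by exact_mod_cast hemod
  have hl1 : (1 : ℝ) ≤ l := by exact_mod_cast hl
  have hed' : (emod : ℝ) ≤ dmod := by exact_mod_cast hed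
  have hE1 : (1 : ℝ) ≤ (2 : ℝ) ^ 12 * 3 ^ 3 * 5 * emod * l := by nlinarith
  have hlogE : 0 ≤ Real.log ((2 : ℝ) ^ 12 * 3 ^ 3 * 5 * emod * l) := Real.log_nonneg hE1
  have hED : (2 : ℝ) ^ 12 * 3 ^ 3 * 5 * emod * l ≤ ((2 ^ 12 * 3 ^ 3 * 5 * dmod : ℕ) : ℝ) * (l : ℝ) := by
    push_cast; nlinarith
  have hlog : Real.log ((2 : ℝ) ^ 12 * 3 ^ 3 * 5 * emod * l) ≤
      Real.log (((2 ^ 12 * 3 ^ 3 * 5 * dmod : ℕ) : ℝ) * (l : ℝ)) :=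
    Real.log_le_log (by linarith) hED
  have hπ : (π (2 ^ 12 * 3 ^ 3 * 5 * emod * l) : ℝ) ≤ (π (2 ^ 12 * 3 ^ 3 * 5 * dmod * l) : ℝ) := by
    exact_mod_cast Nat.monotone_primeCounting (by
      apply Nat.mul_le_mul_right; apply Nat.mul_le_mul_left; exact hed)
  have hπ0 : (0 : ℝ) ≤ (π (2 ^ 12 * 3 ^ 3 * 5 * dmod * l) : ℝ) := Nat.cast_nonneg _
  calc Real.log ((2 : ℝ) ^ 12 * 3 ^ 3 * 5 * emod * l) * sLe
      ≤ Real.log ((2 : ℝ) ^ 12 * 3 ^ 3 * 5 * emod * l) * (π (2 ^ 12 * 3 ^ 3 * 5 * dmod * l) : ℝ) :=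
        mul_le_mul_of_nonneg_left (hsLele.trans hπ) hlogE
    _ ≤ Real.log (((2 ^ 12 * 3 ^ 3 * 5 * dmod : ℕ) : ℝ) * (l : ℝ)) * (π (2 ^ 12 * 3 ^ 3 * 5 * dmod * l) : ℝ) :=
        mul_le_mul_of_nonneg_right hlog hπ0

/-- **Steps (ii)–(iii) assembled** ("Combining this last inequality with the inequality of the final display of Step
(ii) yields `(1 + 4/l)·log(𝔡^K) + (4/l)·log(𝔰^ℚ) ≤ (1 + 12·d_mod/l)·(log(𝔡^{F_tpd}) + log(𝔣^{F_tpd})) + 2·log(l) + 52`",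
p. 26) for reals satisfying the COMBINED Step (ii) bound (ii-K) and the Step (iii) bound — the tree's
`Thm110Numerics.stepiii_final` at the numerics of the point (log 𝔣^K := 0, log 𝔡^F := log 𝔡^{F_tpd} +
log(2^11·3^3·5^2), log 𝔣^F := log 𝔣^{F_tpd}). [cite: Mochizuki2012, IUTchIV Thm. 1.10 proof Step (iii) p. 26]
[claim: Mochizuki2012, status: disputed] -/
theorem stepiii_final_of_bounds (hl : l.Prime) (h5 : 5 ≤ l) {emod : ℕ} (hemod : 1 ≤ emod) (hemod' : emod ≤ dmod P)
    {dK sQ sLe : ℝ} (hdK : 0 ≤ dK) (hsQ : 0 ≤ sQ) (hsLe : 0 ≤ sLe)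
    (hK : dK ≤ P.logDiff + logCondAvoid P {2, l} + Real.log (2 ^ 11 * 3 ^ 3 * 5 ^ 2) + 2 * Real.log l)
    (hsQle : sQ ≤ 2 * (dmod P : ℝ) * (P.logDiff + logCondAvoid P {2, l}) + Real.log (2 * 3 * 5 * (l : ℝ)))
    (hsLele : sLe ≤ (π (2 ^ 12 * 3 ^ 3 * 5 * emod * l) : ℝ)) :
    (1 + 4 / (l : ℝ)) * dK + 4 / (l : ℝ) * sQ ≤
      (1 + 12 * (dmod P : ℝ) / l) * (P.logDiff + logCondAvoid P {2, l}) + 2 * Real.log l + 52 := by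
  have hL : 0 ≤ Real.log (2 ^ 11 * 3 ^ 3 * 5 ^ 2 : ℝ) := Real.log_nonneg (by norm_num)
  -- the numerics of the point (the last three fields are immaterial placeholders)
  let X : Thm110Numerics :=
    { l := l
      prime_l := hl
      five_le_l := h5
      dmod := dmod P
      one_le_dmod := dmod_pos P
      emod := emod
      one_le_emod := hemod
      emod_le_dmod := hemod'
      etaPrm := 1
      etaPrm_pos := one_pos
      logDiffTpd := P.logDiff
      logDiffTpd_nonneg := P.logDiff_nonneg
      logCondTpd := logCondAvoid P {2, l}
      logCondTpd_nonneg := logCondAvoid_nonneg P _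
      logDiffF := P.logDiff + Real.log (2 ^ 11 * 3 ^ 3 * 5 ^ 2)
      logDiffF_nonneg := add_nonneg P.logDiff_nonneg hL
      logCondF := logCondAvoid P {2, l}
      logCondF_nonneg := logCondAvoid_nonneg P _
      logq := 1
      logq_pos := one_pos
      negLogTheta := ((l : ℝ) + 1) / 4 * ((1 + 4 / (l : ℝ)) * dK - 1 / 6 * 1 + 4 / (l : ℝ) * sQ
        + 20 / 3 * Real.log (((2 ^ 12 * 3 ^ 3 * 5 * emod : ℕ) : ℝ) * l) * sLe) + ((l : ℝ) + 5) / 4 * Real.log Real.pi }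
  let PD : X.ProofData :=
    { logDiffK := dK
      logDiffK_nonneg := hdK
      logCondK := 0
      logCondK_nonneg := le_rfl
      logsQ := sQ
      logsQ_nonneg := hsQ
      logsLe := sLe
      logsLe_nonneg := hsLe
      tpd_le_F := by show P.logDiff + logCondAvoid P {2, l} ≤ _; linarith
      F_le := by
        show P.logDiff + Real.log (2 ^ 11 * 3 ^ 3 * 5 ^ 2) + logCondAvoid P {2, l} ≤ _; linarith
      K_le := by show dK + 0 ≤ _; linarith
      sQ_le := hsQle
      sLe_le := by show sLe ≤ (π (X.estar * X.l) : ℝ); exact hsLele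
      hull_le := by
        show _ ≤ ((l : ℝ) + 1) / 4 * ((1 + 4 / (l : ℝ)) * dK - 1 / 6 * 1 + 4 / (l : ℝ) * sQ
          + 20 / 3 * X.lstar * sLe) + ((l : ℝ) + 5) / 4 * Real.log Real.pi
        unfold Thm110Numerics.lstar Thm110Numerics.estar
        exact le_rfl }
  exact Thm110Numerics.stepiii_final PD

/-- **S-b (tower arithmetic), number-free half: `δ_K ≤ B_III(P, l)`.** For a prime `l ≥ 5`, `1 ≤ e_mod ≤ d_mod`,
nonnegative reals `log(𝔡^K)`, `log(𝔰^ℚ)`, `log(𝔰^≤)` with the combined Step (ii) bound (ii-K), the Step (iii) bound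
and `log(𝔰^≤) ≤ π(e*_mod·l)`, the K-level Step (v) bound

  `δ_K = (l+1)/4·{(1 + 4/l)·log(𝔡^K) + (4/l)·log(𝔰^ℚ) + (20/3)·log(e*_mod·l)·log(𝔰^≤)}`

is at most the registered constant of the layer-2 skeleton of `ThetaPartII` (v1.2),

  `B_III(P,l) = (l+1)/4·{(1 + 12·d_mod/l)·(log-diff + log 𝔣^{∤{2,l}}) + 2·log l + 52 + (20/3)·log(d*_mod·l)·π(d*_mod·l)}`

— so that S-a's `δΣ(T) ≤ δ_K(T)` and `hullEstimateOf_mono` give `Cor22.HullVolumeAtDatum P l (B_III P l)` once the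
three bounds are supplied for the datum's genuine numbers (abc-iut-S-d1 / L5-t15 instance forms).
[cite: Mochizuki2012, IUTchIV Thm. 1.10 proof Step (iii) p. 26] [cite: Mochizuki2012, IUTchIV Thm. 1.10 proof Step (v)
p. 29] [claim: Mochizuki2012, status: disputed] -/
theorem deltaK_le_BIII (hl : l.Prime) (h5 : 5 ≤ l) {emod : ℕ} (hemod : 1 ≤ emod) (hemod' : emod ≤ dmod P)
    {dK sQ sLe : ℝ} (hdK : 0 ≤ dK) (hsQ : 0 ≤ sQ) (hsLe : 0 ≤ sLe)
    (hK : dK ≤ P.logDiff + logCondAvoid P {2, l} + Real.log (2 ^ 11 * 3 ^ 3 * 5 ^ 2) + 2 * Real.log l)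
    (hsQle : sQ ≤ 2 * (dmod P : ℝ) * (P.logDiff + logCondAvoid P {2, l}) + Real.log (2 * 3 * 5 * (l : ℝ)))
    (hsLele : sLe ≤ (π (2 ^ 12 * 3 ^ 3 * 5 * emod * l) : ℝ)) :
    ((l : ℝ) + 1) / 4 * ((1 + 4 / (l : ℝ)) * dK + 4 / (l : ℝ) * sQ
        + 20 / 3 * Real.log ((2 : ℝ) ^ 12 * 3 ^ 3 * 5 * emod * l) * sLe) ≤
      ((l : ℝ) + 1) / 4 * ((1 + 12 * (dmod P : ℝ) / l) * (P.logDiff + logCondAvoid P {2, l}) + 2 * Real.log l + 52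
        + 20 / 3 * Real.log (((2 ^ 12 * 3 ^ 3 * 5 * dmod P : ℕ) : ℝ) * (l : ℝ))
          * (Nat.primeCounting (2 ^ 12 * 3 ^ 3 * 5 * dmod P * l) : ℝ)) := by
  have h1 := stepiii_final_of_bounds hl h5 hemod hemod' hdK hsQ hsLe hK hsQle hsLele
  have h2 := log_estar_mul_sLe_le (dmod := dmod P) hl.one_lt.le hemod hemod' hsLele
  have hl0 : (0 : ℝ) ≤ ((l : ℝ) + 1) / 4 := by positivity
  have h3 : (1 + 4 / (l : ℝ)) * dK + 4 / (l : ℝ) * sQ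
      + 20 / 3 * Real.log ((2 : ℝ) ^ 12 * 3 ^ 3 * 5 * emod * l) * sLe ≤
      (1 + 12 * (dmod P : ℝ) / l) * (P.logDiff + logCondAvoid P {2, l}) + 2 * Real.log l + 52
        + 20 / 3 * Real.log (((2 ^ 12 * 3 ^ 3 * 5 * dmod P : ℕ) : ℝ) * (l : ℝ))
          * (Nat.primeCounting (2 ^ 12 * 3 ^ 3 * 5 * dmod P * l) : ℝ) := by
    have h20 := mul_le_mul_of_nonneg_left h2 (show (0 : ℝ) ≤ 20 / 3 by norm_num)
    linarith
  exact mul_le_mul_of_nonneg_left h3 hl0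

/-! ## The same with print's OWN slack: `log(𝔡^K) ≤ log(𝔡^{F_tpd}) + log(𝔣^{F_tpd}) + 2·log(l) + 21` suffices

Step (ii)'s third display is printed as "`≤ log(𝔡^{F_tpd}) + log(𝔣^{F_tpd}) + 2·log(l) + 21`" (p. 24), i.e. with
`log(2^11·3^3·5^2) ≈ 14.14` rounded up to `21`, and only THIS line is consumed by the final display of Step (ii) and
by Step (iii). So the tower arithmetic reaches `B_III(P, l)` from any K-level bound with a `2`-adic budget up to
`2^20` in place of `2^11` (`log(2^20·3^3·5^2) ≤ 21`) — which makes S-b robust to the cell's model reading v3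
(`F‡ = F_tpd(√−1, √λ, √(λ−1), E_λ[3·5])`, `[F‡ : F_E] ∣ 4`, abc-iut-plan 2026-08-26T02:33:05Z: the wild-at-`2`
constant of (ii-K) re-derived as `log(2^13·3^3·5^2)`). -/

/-- **Steps (ii)–(iii) assembled from the printed `+ 21` line**: for reals `l ≥ 5`, `d_mod ≥ 1`, `L = log(𝔡^{F_tpd}) +
log(𝔣^{F_tpd}) ≥ 0`, and `log(𝔡^K) ≤ L + 2·log(l) + 21`, `log(𝔰^ℚ) ≤ 2·d_mod·L + log(2·3·5·l)`:
`(1 + 4/l)·log(𝔡^K) + (4/l)·log(𝔰^ℚ) ≤ (1 + 12·d_mod/l)·L + 2·log(l) + 52` — print's own derivation ("where we apply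
the estimates `log(l)/l ≤ 1/2` and `1 + 4/l ≤ 2`", p. 24; "cf. (E6); the fact that `l ≥ 5`", "the estimate `d_mod ≥ 1`",
p. 26), the arithmetic of the tree's `Thm110Numerics.stepii_final` / `stepiii_final` over plain reals.
[cite: Mochizuki2012, IUTchIV Thm. 1.10 proof Step (ii) p. 24, Step (iii) p. 26] [claim: Mochizuki2012, status: disputed] -/
theorem stepiii_final_of_le21 {l d L dK sQ : ℝ} (hl : 5 ≤ l) (hd : 1 ≤ d) (hL : 0 ≤ L)
    (hK : dK ≤ L + 2 * Real.log l + 21) (hsQ : sQ ≤ 2 * d * L + Real.log (2 * 3 * 5 * l)) :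
    (1 + 4 / l) * dK + 4 / l * sQ ≤ (1 + 12 * d / l) * L + 2 * Real.log l + 52 := by
  have hl0 : (0 : ℝ) < l := by linarith
  have hlog0 : 0 ≤ Real.log l := Real.log_nonneg (by linarith)
  have hll : Real.log l / l ≤ 1 / 2 := log_div_self_le_half hl0
  have hlogl : Real.log l ≤ l / 2 := by rwa [div_le_iff₀ hl0, one_div_mul_eq_div] at hll
  have h30 : Real.log (2 * 3 * 5 * l) ≤ 5 + Real.log l := log_thirty_mul_le hl0
  have hc : 0 ≤ 1 + 4 / l := by positivity
  have h4l : 4 / l ≤ 1 := by rw [div_le_one hl0]; linarith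
  -- Step (ii), final display: `(1 + 4/l)·log(𝔡^K) ≤ (1 + 4/l)·L + 2·log(l) + 46`
  have h1 := mul_le_mul_of_nonneg_left hK hc
  have h8 : 4 / l * (2 * Real.log l) ≤ 4 := by
    have : 4 / l * (2 * Real.log l) = 8 * (Real.log l / l) := by ring
    rw [this]; linarith
  have e1 : (1 + 4 / l) * (L + 2 * Real.log l + 21) =
      (1 + 4 / l) * L + 2 * Real.log l + 4 / l * (2 * Real.log l) + (1 + 4 / l) * 21 := by ring
  rw [e1] at h1
  have h42 : (1 + 4 / l) * 21 ≤ 42 := by nlinarith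
  -- Step (iii): `(4/l)·log(𝔰^ℚ) ≤ (8·d_mod/l)·L + 6`
  have hc' : 0 ≤ 4 / l := by positivity
  have h2 := mul_le_mul_of_nonneg_left (hsQ.trans (by linarith : 2 * d * L + Real.log (2 * 3 * 5 * l) ≤
    2 * d * L + 5 + Real.log l)) hc'
  have e2 : 4 / l * (2 * d * L + 5 + Real.log l) = 8 * d / l * L + 20 / l + 4 * (Real.log l / l) := by
    field_simp; ring
  rw [e2] at h2
  have h20 : 20 / l ≤ 4 := by rw [div_le_iff₀ hl0]; linarith
  -- combine, `4/l ≤ 4·d_mod/l`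
  have h3 : 4 / l * L ≤ 4 * d / l * L := by
    apply mul_le_mul_of_nonneg_right _ hL
    rw [div_le_div_iff_of_pos_right hl0]; linarith
  have e3 : (1 + 4 / l) * L = L + 4 / l * L := by ring
  have e4 : (1 + 12 * d / l) * L = L + 4 * d / l * L + 8 * d / l * L := by ring
  rw [e3] at h1; rw [e4]
  linarith

/-- **S-b number-free half, robust form: `δ_K ≤ B_III(P, l)` from print's `+ 21` line.** As `deltaK_le_BIII`, with
the Step (ii) input relaxed to `log(𝔡^K) ≤ log-diff + log 𝔣^{∤{2,l}} + 2·log(l) + 21` (p. 24, the printed third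
display's last line) — any wild-at-`2·3·5` constant `log(2^a·3^b·5^c) ≤ 21` will do, e.g. reading v3's
`log(2^13·3^3·5^2)`. [cite: Mochizuki2012, IUTchIV Thm. 1.10 proof Step (ii) p. 24, Step (iii) p. 26, Step (v) p. 29]
[claim: Mochizuki2012, status: disputed] -/
theorem deltaK_le_BIII_of_le21 (hl : l.Prime) (h5 : 5 ≤ l) {emod : ℕ} (hemod : 1 ≤ emod) (hemod' : emod ≤ dmod P)
    {dK sQ sLe : ℝ}
    (hK : dK ≤ P.logDiff + logCondAvoid P {2, l} + 2 * Real.log l + 21)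
    (hsQle : sQ ≤ 2 * (dmod P : ℝ) * (P.logDiff + logCondAvoid P {2, l}) + Real.log (2 * 3 * 5 * (l : ℝ)))
    (hsLele : sLe ≤ (π (2 ^ 12 * 3 ^ 3 * 5 * emod * l) : ℝ)) :
    ((l : ℝ) + 1) / 4 * ((1 + 4 / (l : ℝ)) * dK + 4 / (l : ℝ) * sQ
        + 20 / 3 * Real.log ((2 : ℝ) ^ 12 * 3 ^ 3 * 5 * emod * l) * sLe) ≤
      ((l : ℝ) + 1) / 4 * ((1 + 12 * (dmod P : ℝ) / l) * (P.logDiff + logCondAvoid P {2, l}) + 2 * Real.log l + 52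
        + 20 / 3 * Real.log (((2 ^ 12 * 3 ^ 3 * 5 * dmod P : ℕ) : ℝ) * (l : ℝ))
          * (Nat.primeCounting (2 ^ 12 * 3 ^ 3 * 5 * dmod P * l) : ℝ)) := by
  have hl5 : (5 : ℝ) ≤ l := by exact_mod_cast h5
  have hd : (1 : ℝ) ≤ dmod P := by exact_mod_cast dmod_pos P
  have hL : 0 ≤ P.logDiff + logCondAvoid P {2, l} := add_nonneg P.logDiff_nonneg (logCondAvoid_nonneg P _)
  have h1 := stepiii_final_of_le21 hl5 hd hL hK hsQle
  have h2 := log_estar_mul_sLe_le (dmod := dmod P) hl.one_lt.le hemod hemod' hsLele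
  have hl0 : (0 : ℝ) ≤ ((l : ℝ) + 1) / 4 := by positivity
  have h3 : (1 + 4 / (l : ℝ)) * dK + 4 / (l : ℝ) * sQ
      + 20 / 3 * Real.log ((2 : ℝ) ^ 12 * 3 ^ 3 * 5 * emod * l) * sLe ≤
      (1 + 12 * (dmod P : ℝ) / l) * (P.logDiff + logCondAvoid P {2, l}) + 2 * Real.log l + 52
        + 20 / 3 * Real.log (((2 ^ 12 * 3 ^ 3 * 5 * dmod P : ℕ) : ℝ) * (l : ℝ))
          * (Nat.primeCounting (2 ^ 12 * 3 ^ 3 * 5 * dmod P * l) : ℝ) := by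
    have h20 := mul_le_mul_of_nonneg_left h2 (show (0 : ℝ) ≤ 20 / 3 by norm_num)
    linarith
  exact mul_le_mul_of_nonneg_left h3 hl0

/-- `log(2^a·3^3·5^2) ≤ 21` for `a ≤ 13`, in particular reading v3's wild-at-`2` budget `a = 13` (and print's `a = 11`):
the constant of any such (ii-K) bound feeds `deltaK_le_BIII_of_le21`. [cite: Mochizuki2012, IUTchIV Thm. 1.10 proof Step (ii) p. 24] -/
theorem log_two_pow_thirteen_mul_le : Real.log (2 ^ 13 * 3 ^ 3 * 5 ^ 2) ≤ 21 := by
  have h2 : Real.log 2 ≤ 0.6931471808 := Real.log_two_lt_d9.le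
  have h3 : Real.log 3 ≤ 2 := by
    have := Real.log_le_sub_one_of_pos (show (0 : ℝ) < 3 by norm_num); linarith
  have he := Real.exp_one_gt_d9
  have h5' : (5 : ℝ) ≤ Real.exp 2 := by
    have : Real.exp 2 = Real.exp 1 * Real.exp 1 := by rw [← Real.exp_add]; norm_num
    rw [this]; nlinarith
  have h5 : Real.log 5 ≤ 2 := by
    calc Real.log 5 ≤ Real.log (Real.exp 2) := Real.log_le_log (by norm_num) h5'
      _ = 2 := Real.log_exp 2
  rw [Real.log_mul (by norm_num) (by norm_num), Real.log_mul (by norm_num) (by norm_num),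
    Real.log_pow, Real.log_pow, Real.log_pow]
  push_cast
  linarith

end Cor22

end Literature.IUT.LogVolume

end
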